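import Mathlib.Combinatorics.SimpleGraph.Finite
import Mathlib.Algebra.Order.BigOperators.Group.Finset
import Mathlib.Algebra.Order.Field.Basic
import Mathlib.Data.Nat.Choose.Sum
import Mathlib.Data.Real.Basic

/-!
# Route RamseyUncertifiable, crux `RegularResolutionRung` (stmt-PneNP-9818): vocabulary of the line
`sound-path-bottleneck` (definitions)

Objects posited by the line `sound-path-bottleneck` for the crux
`Summit.PneNP.PneNP.Theses.RamseyUncertifiable.RegularResolutionRung` (skeleton
`Summits/PneNP/PneNP/Cruxes/RegularResolutionRung/Lines/sound-path-bottleneck.lean`, whose registered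
stubs are stated in exactly this vocabulary and namespace):

* `edgeCount H A B` — ordered pair count `e(A,B) = #{(a,b) ∈ A × B : a ∼ b}` (Lauria–Pudlák–Rödl–Thapen,
  arXiv:1303.3166, Def. 10, ordered version);
* `LowerBiDense H M δ` / `UpperBiDense H M δ` — the two halves of Prömel–Rödl bi-density at scale `M`
  (`δ|A||B| ≤ e(A,B) ≤ (1-δ)|A||B|` whenever `|A|,|B| ≥ M`; PromelRodl1999, LPRT13 Lemma 11);
* `commonNbhd H U` — the common neighbourhood `N̂(U)`;
* `SoundlyOrderable H δ L₀ Q` — `Q` can be listed so that each element keeps a `δ`-fraction of the common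
  neighbourhood of every `≤ L₀`-subset of its predecessors (the dense-extension test of LPRT13 Cor. 12,
  imposed on every accepted vertex by the path distribution of the line);
* `IsTrap H δ L₀ r b q q' W T B`, `trapWeight`, `SoundTrapSparseAt` — the line's substitute for property 2
  ("mostly dense", Def. 6.2) of Atserias–Bonacina–de Rezende–Lauria–Nordström–Razborov, arXiv:2012.09476 §6:
  inclusion-minimal sound `W`-traps over a pinned set `T`, their spread weight `Σ_B θ^{|B|}`, and its
  uniform bound;
* `refCount k L₀ = Σ_{l ≤ L₀} C(k,l)` — the number of reference sets of an accepted set of size `≤ k`.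

A short API (`edgeCount_eq_sum`, `commonNbhd_empty`, `commonNbhd_insert`, `commonNbhd_chain_lb`,
`junk_card_lt`) is proved here because every stub of the line uses it. Definitions and elementary lemmas
only; no fact is asserted. The stubs and the composition live in the skeleton and land as
`RamseyUncertifiableRegularResolutionRung*.lean`. [folklore]
-/

noncomputable section

open scoped BigOperators

namespace Summit.PneNP.PneNP.Cruxes.RegularResolutionRung.SoundPathBottleneck

open Finset

set_option linter.dupNamespace false -- `Summit.PneNP.PneNP.…`: summit = sub-problem name (single-conjunct summit, D-0017)

variable {m : ℕ}

/-- Ordered pair count `e(A,B) = #{(a,b) ∈ A × B : a ∼ b}` (LPRT13 Def. 10, ordered version: for `A = B`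
every edge is counted twice and the diagonal never). [folklore] -/
def edgeCount (H : SimpleGraph (Fin m)) [DecidableRel H.Adj] (A B : Finset (Fin m)) : ℕ :=
  ((A ×ˢ B).filter fun p => H.Adj p.1 p.2).card

/-- Lower bi-density at scale `M` with density `δ`: every pair of `M`-large vertex sets spans at least a
`δ`-fraction of the possible ordered pairs (the half of Prömel–Rödl used by LPRT13). [folklore] -/
def LowerBiDense (H : SimpleGraph (Fin m)) [DecidableRel H.Adj] (M : ℕ) (δ : ℝ) : Prop :=
  ∀ A B : Finset (Fin m), M ≤ A.card → M ≤ B.card → δ * A.card * B.card ≤ (edgeCount H A B : ℝ)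

/-- Upper bi-density at scale `M` with density `δ`: every pair of `M`-large vertex sets spans at most a
`(1-δ)`-fraction of the possible ordered pairs (the half of Prömel–Rödl not used by LPRT13; it separates
Ramsey cores from complete `(k-1)`-partite graphs and from complete joins). [folklore] -/
def UpperBiDense (H : SimpleGraph (Fin m)) [DecidableRel H.Adj] (M : ℕ) (δ : ℝ) : Prop :=
  ∀ A B : Finset (Fin m), M ≤ A.card → M ≤ B.card → (edgeCount H A B : ℝ) ≤ (1 - δ) * A.card * B.card

/-- Common neighbourhood `N̂(U) = {v : ∀ u ∈ U, u ∼ v}` (all of `V` for `U = ∅`). [folklore] -/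
def commonNbhd (H : SimpleGraph (Fin m)) [DecidableRel H.Adj] (U : Finset (Fin m)) : Finset (Fin m) :=
  univ.filter fun v => ∀ u ∈ U, H.Adj u v

/-- `Q` is SOUNDLY ORDERABLE (w.r.t. `δ`, `L₀`): it can be listed without repetition so that every element
keeps a `δ`-fraction of the common neighbourhood of EVERY `≤ L₀`-subset of its predecessors. [folklore] -/
def SoundlyOrderable (H : SimpleGraph (Fin m)) [DecidableRel H.Adj] (δ : ℝ) (L₀ : ℕ)
    (Q : Finset (Fin m)) : Prop :=
  ∃ l : List (Fin m), l.Nodup ∧ l.toFinset = Q ∧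
    ∀ (j : ℕ) (hj : j < l.length), ∀ U ⊆ (l.take j).toFinset, U.card ≤ L₀ →
      δ * ((commonNbhd H U).card : ℝ) ≤ ((commonNbhd H (insert (l.get ⟨j, hj⟩) U)).card : ℝ)

/-- `B` is a (minimal, sound) `W`-TRAP over the pinned set `T` (the data of Case 2a of the bottleneck count
of arXiv:2012.09476 Lemma 6.7, with the hitting set of Def. 6.2 replaced by minimality): `|B| ≤ b`, `T` and
`B` are disjoint, the trap CLOSES (`< q'` common `W`-neighbours of `T ∪ B`) although every `≤ r`-subset of
`T ∪ B` has `≥ q` common `W`-neighbours, `B` is inclusion-minimal with the closing property, and `T ∪ B`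
is soundly orderable. [folklore] -/
structure IsTrap (H : SimpleGraph (Fin m)) [DecidableRel H.Adj] (δ : ℝ) (L₀ r b q q' : ℕ)
    (W T B : Finset (Fin m)) : Prop where
  /-- at most `b` vertices are accepted between the two bottleneck nodes -/
  card_le : B.card ≤ b
  /-- the pinned set and the trap are disjoint -/
  disjoint : Disjoint T B
  /-- the trap closes: fewer than `q'` common `W`-neighbours of `T ∪ B` -/
  closes : (W ∩ commonNbhd H (T ∪ B)).card < q'
  /-- every `≤ r`-subset of `T ∪ B` is `q`-dense into `W` -/
  dense : ∀ R ⊆ T ∪ B, R.card ≤ r → q ≤ (W ∩ commonNbhd H R).card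
  /-- `B` is inclusion-minimal with the closing property -/
  minimal : ∀ B' ⊂ B, q' ≤ (W ∩ commonNbhd H (T ∪ B')).card
  /-- `T ∪ B` passes the dense-extension test in some order -/
  sound : SoundlyOrderable H δ L₀ (T ∪ B)

open scoped Classical in
/-- The SPREAD WEIGHT of the `W`-traps over `T`: `Σ_{B trap} θ^{|B|}`. [folklore] -/
def trapWeight (H : SimpleGraph (Fin m)) [DecidableRel H.Adj] (δ : ℝ) (L₀ r b q q' : ℕ) (θ : ℝ)
    (W T : Finset (Fin m)) : ℝ :=
  ∑ B : Finset (Fin m), if IsTrap H δ L₀ r b q q' W T B then θ ^ B.card else 0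

/-- SOUND-TRAP SPARSITY of `H` at the given parameters: for every vertex set `W` and every pinned set `T`
with `|T| ≤ r/2`, the spread weight of the `W`-traps over `T` is at most `τ`. [folklore] -/
def SoundTrapSparseAt (H : SimpleGraph (Fin m)) [DecidableRel H.Adj] (δ : ℝ) (L₀ r b q q' : ℕ)
    (θ τ : ℝ) : Prop :=
  ∀ W T : Finset (Fin m), T.card ≤ r / 2 → trapWeight H δ L₀ r b q q' θ W T ≤ τ

/-- Number of reference sets `U' ⊆ ACC`, `|U'| ≤ L₀`, of an accepted set of size `≤ k`: `Σ_{l ≤ L₀} C(k,l)`. [folklore] -/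
def refCount (k L₀ : ℕ) : ℕ :=
  ∑ l ∈ Finset.range (L₀ + 1), k.choose l

/-! ## Basic API -/

/-- `e(A,B) = Σ_{a ∈ A} |N(a) ∩ B|`. -/
theorem edgeCount_eq_sum (H : SimpleGraph (Fin m)) [DecidableRel H.Adj] (A B : Finset (Fin m)) :
    edgeCount H A B = ∑ a ∈ A, (B.filter fun b => H.Adj a b).card := by
  unfold edgeCount
  rw [Finset.card_filter, Finset.sum_product]
  refine Finset.sum_congr rfl fun a _ => ?_
  rw [Finset.card_filter]

/-- Under lower bi-density at scale `M`, fewer than `M` vertices see less than a `δ`-fraction of an `M`-large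
set `Y` (LPRT13 Lemma 11 ⇒ Cor. 12). -/
theorem junk_card_lt (H : SimpleGraph (Fin m)) [DecidableRel H.Adj] {M : ℕ} {δ : ℝ}
    (hlo : LowerBiDense H M δ) (hM : 0 < M) (Y : Finset (Fin m)) (hY : M ≤ Y.card) :
    (univ.filter fun w => ((Y.filter fun y => H.Adj w y).card : ℝ) < δ * Y.card).card < M := by
  by_contra hJ
  push Not at hJ
  set J := univ.filter fun w => ((Y.filter fun y => H.Adj w y).card : ℝ) < δ * Y.card with hJdef
  have h1 := hlo J Y hJ hY
  rw [edgeCount_eq_sum] at h1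
  push_cast at h1
  have hne : J.Nonempty := Finset.card_pos.1 (lt_of_lt_of_le hM hJ)
  have h2 : ∑ a ∈ J, ((Y.filter fun b => H.Adj a b).card : ℝ) < ∑ a ∈ J, δ * Y.card :=
    Finset.sum_lt_sum_of_nonempty hne fun a ha => (Finset.mem_filter.1 ha).2
  rw [Finset.sum_const, nsmul_eq_mul] at h2
  have h3 : (J.card : ℝ) * (δ * Y.card) = δ * J.card * Y.card := by ring
  linarith

/-- `N̂(∅) = V`. -/
theorem commonNbhd_empty (H : SimpleGraph (Fin m)) [DecidableRel H.Adj] :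
    commonNbhd H ∅ = univ := by
  unfold commonNbhd
  exact Finset.filter_true_of_mem fun v _ => by simp

/-- `N̂(insert u U) = N(u) ∩ N̂(U)`. -/
theorem commonNbhd_insert (H : SimpleGraph (Fin m)) [DecidableRel H.Adj] (u : Fin m)
    (U : Finset (Fin m)) :
    commonNbhd H (insert u U) = (commonNbhd H U).filter fun v => H.Adj u v := by
  unfold commonNbhd
  ext v
  simp [Finset.mem_filter, and_comm]

/-- The soundness chain bound: along a list in which every element keeps a `δ`-fraction of the common
neighbourhood of its predecessors, the whole list has at least `δ^{length}·m` common neighbours. -/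
theorem commonNbhd_chain_lb (H : SimpleGraph (Fin m)) [DecidableRel H.Adj] {δ : ℝ} (hδ : 0 ≤ δ) :
    ∀ l : List (Fin m),
      (∀ (j : ℕ) (hj : j < l.length),
        δ * ((commonNbhd H (l.take j).toFinset).card : ℝ) ≤
          ((commonNbhd H (insert (l.get ⟨j, hj⟩) (l.take j).toFinset)).card : ℝ)) →
      δ ^ l.length * (m : ℝ) ≤ ((commonNbhd H l.toFinset).card : ℝ) := by
  intro l
  induction l using List.reverseRecOn with
  | nil =>
    intro _
    simp [commonNbhd_empty]
  | append_singleton l x ih =>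
    intro hl
    have hlen : (l ++ [x]).length = l.length + 1 := by simp
    have hl' : ∀ (j : ℕ) (hj : j < l.length),
        δ * ((commonNbhd H (l.take j).toFinset).card : ℝ) ≤
          ((commonNbhd H (insert (l.get ⟨j, hj⟩) (l.take j).toFinset)).card : ℝ) := by
      intro j hj
      have hj' : j < (l ++ [x]).length := by rw [hlen]; omega
      have h := hl j hj'
      have htake : (l ++ [x]).take j = l.take j := List.take_append_of_le_length hj.le
      have hget : (l ++ [x]).get ⟨j, hj'⟩ = l.get ⟨j, hj⟩ := by
        simp [List.getElem_append_left hj]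
      rwa [htake, hget] at h
    have ih' := ih hl'
    have hlast := hl l.length (by rw [hlen]; omega)
    have htake : (l ++ [x]).take l.length = l := by simp
    have hget : (l ++ [x]).get ⟨l.length, by rw [hlen]; omega⟩ = x := by simp
    rw [htake, hget] at hlast
    have hfin : (l ++ [x]).toFinset = insert x l.toFinset := by
      ext v; simp
    rw [hfin, hlen, pow_succ]
    calc δ ^ l.length * δ * (m : ℝ) = δ * (δ ^ l.length * (m : ℝ)) := by ring
      _ ≤ δ * ((commonNbhd H l.toFinset).card : ℝ) := mul_le_mul_of_nonneg_left ih' hδ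
      _ ≤ _ := hlast

/-- Vocabulary anchor (registered sub-goal `defs_anchor` of stmt-PneNP-9818): the Defs file of the line is
credited through this restatement of `commonNbhd_insert` in closed `∀`-form. -/
theorem defs_anchor :
    ∀ (m : ℕ) (H : SimpleGraph (Fin m)) [DecidableRel H.Adj] (U : Finset (Fin m)) (u : Fin m),
      commonNbhd H (insert u U) = (commonNbhd H U).filter fun v => H.Adj u v :=
  fun _ H _ U u => commonNbhd_insert H u U

end Summit.PneNP.PneNP.Cruxes.RegularResolutionRung.SoundPathBottleneck
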